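import Mathlib.Tactic.LinearCombination
import Mathlib.Tactic.Ring
import Summits.MatrixMultiplication.OmegaCensus.DihC3SqCheckers

/-!
# ω-census, family (b3): the class `𝒞₂` — symmetries of the fibre model (transport of `Bound16`)

HONEST FRAMING (pub-omega census; verbatim): lottery ticket; floor = certified bounds/negative ranges.
Census BOOKKEEPING (prereg P-031.3, session A2); group-free; nothing here is progress on `ω`.

The bound `Bound16 n` ("no independent `17`-set in the model graph of configuration `n`") is moved along the model
symmetries, each realised by an explicit graph embedding `(p, λ) ↦ (π p, A λ + c_p)`:
* `bound16_transport` — the generic statement: a position injection `π`, an invertible `A ∈ GL₂(F₃)` and offsets `c_p` with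
  `d_{n'}(π p, π q) = A d_n(p, q) + c_p − c_q` give `Bound16 n' → Bound16 n`;
* `Hol(F₃²) = F₃² ⋊ GL₂(F₃)` acting on all labels (`holCfg`; rotations `k ↦ A k`, reflections `k ↦ A k + b`): identity with
  `c_p = −[exactly one of t_p, u_p is a reflection] · b` (`dv_holCfg`), hence `bound16_of_holCfg`;
* re-basing `T ↦ T t₁⁻¹`, `U ↦ U u₁⁻¹` and sorting (`rebT`, `rebU`, `srtT`, `srtU`): `d` changes by the sign of `t₁` (resp. `u₁`)
  after a position permutation (`bound16_rebT` …).
The coordinate `d` is read in `ZMod 3 × ZMod 3` through the tree's `CentreIndexSix.dn_cast` (`dv_formula`).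
-/

open Finset

namespace Summit.MatrixMultiplication.OmegaCensus.DihC3Sq

open CentreIndexSix IndepSearch

/-! ## Vectors and signs in `ZMod 3` -/

/-- The `F₃²`-vector of a label / lift index `a` (`(a % 3, a / 3 % 3)`). [folklore] -/
def vec (a : ℕ) : ZMod 3 × ZMod 3 := (((a % 3 : ℕ) : ZMod 3), ((a / 3 % 3 : ℕ) : ZMod 3))

/-- The sign of a label `l < 18` as `±1 : ZMod 3`. [folklore] -/
def sg (l : ℕ) : ZMod 3 := if l < 9 then 1 else -1

/-- The reflection indicator of a label (`0` for rotations, `1` for reflections). [folklore] -/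
def rf (l : ℕ) : ZMod 3 := if l < 9 then 0 else 1

/-- The lift index of a vector. [folklore] -/
def lidx (x : ZMod 3 × ZMod 3) : ℕ := x.1.val + 3 * x.2.val

/-- `2 × 2` matrices over `ZMod 3` act on vectors. [folklore] -/
def mv (a b c d : ZMod 3) (x : ZMod 3 × ZMod 3) : ZMod 3 × ZMod 3 := (a * x.1 + b * x.2, c * x.1 + d * x.2)

/-- `d(p, q)` of configuration `n` as a vector. [folklore] -/
def dv (n p q : ℕ) : ZMod 3 × ZMod 3 := (((dpp n p q 0 : ℕ) : ZMod 3), ((dpp n p q 1 : ℕ) : ZMod 3))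

/-- Lift indices are `< 9`. [folklore] -/
theorem lidx_lt (x : ZMod 3 × ZMod 3) : lidx x < 9 := by
  unfold lidx; have := x.1.val_lt; have := x.2.val_lt; omega

/-- `vec ∘ lidx = id`. [folklore] -/
theorem vec_lidx : ∀ x : ZMod 3 × ZMod 3, vec (lidx x) = x := by decide

/-- `lidx ∘ vec = id` on indices `< 9`. [folklore] -/
theorem lidx_vec : ∀ a < 9, lidx (vec a) = a := by decide

/-- Component labels in terms of `vec` / `sg`. [folklore] -/
theorem kOf_lab1 : ∀ l < 18, kOf (lab1 l 0) = (vec l).1 ∧ kOf (lab1 l 1) = (vec l).2 ∧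
    eOf (lab1 l 0) = sg l ∧ eOf (lab1 l 1) = sg l := by decide

/-- Component labels are `< 6`. [folklore] -/
theorem lab1_lt (l c : ℕ) (hl : l < 18) : lab1 l c < 6 := by unfold lab1; omega

/-- `T`-labels are `< 18`. [folklore] -/
theorem labT_lt (n i : ℕ) : labT n i < 18 := by unfold labT; split_ifs <;> omega
/-- `U`-labels are `< 18`. [folklore] -/
theorem labU_lt (n j : ℕ) : labU n j < 18 := by unfold labU; split_ifs <;> omega

/-- **The word formula, vector form.** [folklore] -/
theorem dv_formula (n p q : ℕ) :
    dv n p q = -(sg (labT n (q / 3)) * sg (labU n (q % 3))) •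
      (vec (labT n (p / 3)) - (sg (labT n (p / 3)) * sg (labT n (q / 3))) • vec (labT n (q / 3)) +
        (sg (labT n (p / 3)) * sg (labT n (q / 3))) •
          (vec (labU n (p % 3)) - (sg (labU n (p % 3)) * sg (labU n (q % 3))) • vec (labU n (q % 3)))) := by
  set t := labT n (p / 3); set t' := labT n (q / 3); set u := labU n (p % 3); set u' := labU n (q % 3)
  have ht := labT_lt n (p / 3); have ht' := labT_lt n (q / 3); have hu := labU_lt n (p % 3); have hu' := labU_lt n (q % 3)
  obtain ⟨t0, t1, te, te'⟩ := kOf_lab1 t ht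
  obtain ⟨t0', t1', tf, tf'⟩ := kOf_lab1 t' ht'
  obtain ⟨u0, u1, ue, ue'⟩ := kOf_lab1 u hu
  obtain ⟨u0', u1', uf, uf'⟩ := kOf_lab1 u' hu'
  ext
  · have h := dn_cast (lab1 t 0) (lab1_lt t 0 ht) (lab1 t' 0) (lab1_lt t' 0 ht') (lab1 u 0) (lab1_lt u 0 hu) (lab1 u' 0)
      (lab1_lt u' 0 hu')
    simp only [dv, dpp, t0, t0', u0, u0', te, tf, ue, uf] at h ⊢
    rw [h]; simp only [Prod.smul_fst, Prod.fst_add, Prod.fst_sub, smul_eq_mul]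
  · have h := dn_cast (lab1 t 1) (lab1_lt t 1 ht) (lab1 t' 1) (lab1_lt t' 1 ht') (lab1 u 1) (lab1_lt u 1 hu) (lab1 u' 1)
      (lab1_lt u' 1 hu')
    simp only [dv, dpp, t1, t1', u1, u1', te', tf', ue', uf'] at h ⊢
    rw [h]; simp only [Prod.smul_snd, Prod.snd_add, Prod.snd_sub, smul_eq_mul]

/-- `shiftIdx` read in vectors. [folklore] -/
theorem vec_shiftIdx : ∀ a < 9, ∀ s0 < 6, ∀ s1 < 6,
    vec (shiftIdx a s0 s1) = vec a + (((s0 : ℕ) : ZMod 3), ((s1 : ℕ) : ZMod 3)) := by decide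

/-- **Adjacency semantics, vector form.** [folklore] -/
theorem adj_iff_vec (n v w : ℕ) : (adjRow (packAdj n) v).testBit w = true ↔
    v < 81 ∧ w < 81 ∧ v / 9 ≠ w / 9 ∧
      (vec (w % 9) = vec (v % 9) + 2 • dv n (v / 9) (w / 9) ∨ vec (w % 9) = vec (v % 9) + dv n (w / 9) (v / 9)) := by
  rw [adj_iff]
  have hv : v % 9 < 9 := Nat.mod_lt _ (by norm_num)
  have hw : w % 9 < 9 := Nat.mod_lt _ (by norm_num)
  have d0 := dpp_lt n (v / 9) (w / 9) 0; have d1 := dpp_lt n (v / 9) (w / 9) 1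
  have e0 := dpp_lt n (w / 9) (v / 9) 0; have e1 := dpp_lt n (w / 9) (v / 9) 1
  have A : ∀ s0 < 6, ∀ s1 < 6, (w % 9 = shiftIdx (v % 9) s0 s1 ↔
      vec (w % 9) = vec (v % 9) + (((s0 : ℕ) : ZMod 3), ((s1 : ℕ) : ZMod 3))) := by
    intro s0 hs0 s1 hs1
    rw [← vec_shiftIdx _ hv s0 hs0 s1 hs1]
    constructor
    · intro h; rw [h]
    · intro h
      have := congrArg lidx h
      rwa [lidx_vec _ hw, lidx_vec _ (shiftIdx_lt _ _ _)] at this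
  have B : (((2 * dpp n (v / 9) (w / 9) 0 : ℕ) : ZMod 3), (((2 * dpp n (v / 9) (w / 9) 1 : ℕ)) : ZMod 3)) =
      2 • dv n (v / 9) (w / 9) := by
    simp only [dv, Nat.cast_mul, Nat.cast_ofNat, Prod.smul_mk, nsmul_eq_mul]
  rw [A _ (by omega) _ (by omega), A _ (by omega) _ (by omega), B]
  rfl

/-! ## The generic transport -/

/-- Invertible matrices act injectively. [folklore] -/
theorem mv_inj : ∀ a b c d : ZMod 3, a * d - b * c ≠ 0 → ∀ x y : ZMod 3 × ZMod 3, mv a b c d x = mv a b c d y → x = y := by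
  decide

/-- Matrices act additively. [folklore] -/
theorem mv_add (a b c d : ZMod 3) (x y : ZMod 3 × ZMod 3) : mv a b c d (x + y) = mv a b c d x + mv a b c d y := by
  ext <;> simp [mv] <;> ring

/-- Matrices respect subtraction. [folklore] -/
theorem mv_sub (a b c d : ZMod 3) (x y : ZMod 3 × ZMod 3) : mv a b c d (x - y) = mv a b c d x - mv a b c d y := by
  ext <;> simp [mv] <;> ring

/-- Matrices commute with doubling. [folklore] -/
theorem mv_two_smul (a b c d : ZMod 3) (x : ZMod 3 × ZMod 3) : mv a b c d (2 • x) = 2 • mv a b c d x := by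
  ext <;> simp [mv] <;> ring

/-- `3 = 0` in `F₃²`. [folklore] -/
theorem three_smul_eq_zero (x : ZMod 3 × ZMod 3) : x + x + x = 0 := by
  ext <;> simp <;> ring_nf <;> rw [show (3 : ZMod 3) = 0 from rfl] <;> simp

/-- **Transport of `Bound16` along a model symmetry.** A position injection `π`, an invertible matrix `A` and offsets `c_p`
with `d_{n'}(π p, π q) = A d_n(p,q) + c_p − c_q` (`p ≠ q`) give the graph embedding `(p, λ) ↦ (π p, A λ + c_p)` of the model
graph of `n` into that of `n'`, so `Bound16 n' → Bound16 n`. [folklore] -/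
theorem bound16_transport {n n' : ℕ} (π : ℕ → ℕ) (hπ : ∀ p < 9, π p < 9) (hπi : ∀ p < 9, ∀ q < 9, π p = π q → p = q)
    (a b c d : ZMod 3) (hdet : a * d - b * c ≠ 0) (cv : ℕ → ZMod 3 × ZMod 3)
    (hid : ∀ p < 9, ∀ q < 9, p ≠ q → dv n' (π p) (π q) = mv a b c d (dv n p q) + cv p - cv q) :
    Bound16 n' → Bound16 n := by
  classical
  intro h I hI hsub
  set φ : ℕ → ℕ := fun v => 9 * π (v / 9) + lidx (mv a b c d (vec (v % 9)) + cv (v / 9)) with hφ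
  have hφ9 : ∀ v, φ v / 9 = π (v / 9) ∧ φ v % 9 = lidx (mv a b c d (vec (v % 9)) + cv (v / 9)) := fun v => by
    have := lidx_lt (mv a b c d (vec (v % 9)) + cv (v / 9)); simp only [hφ]; omega
  have hφ81 : ∀ v < 81, φ v < 81 := fun v hv => by
    have := lidx_lt (mv a b c d (vec (v % 9)) + cv (v / 9)); have := hπ (v / 9) (by omega); simp only [hφ]; omega
  have hvecφ : ∀ v, vec (φ v % 9) = mv a b c d (vec (v % 9)) + cv (v / 9) := fun v => by rw [(hφ9 v).2, vec_lidx]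
  have hI81 : ∀ v ∈ I, v < 81 := fun v hv => (hsub v hv).1
  -- injectivity on `I`
  have hinj : Set.InjOn φ I := by
    intro v hv w hw hvw
    have hp : v / 9 = w / 9 := by
      have h1 := (hφ9 v).1; have h2 := (hφ9 w).1
      exact hπi _ (by have := hI81 v hv; omega) _ (by have := hI81 w hw; omega) (by rw [← h1, ← h2, hvw])
    have hl : vec (v % 9) = vec (w % 9) := by
      have h1 := hvecφ v; have h2 := hvecφ w
      rw [hvw, hp] at h1
      exact mv_inj a b c d hdet _ _ (add_right_cancel (h1.symm.trans h2))
    have : v % 9 = w % 9 := by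
      have := congrArg lidx hl
      rwa [lidx_vec _ (Nat.mod_lt _ (by norm_num)), lidx_vec _ (Nat.mod_lt _ (by norm_num))] at this
    omega
  -- adjacency is reflected
  have hrefl : ∀ v ∈ I, ∀ w ∈ I, v ≠ w → (adjRow (packAdj n') (φ v)).testBit (φ w) = true →
      (adjRow (packAdj n) v).testBit w = true := by
    intro v hv w hw _ hadj
    rw [adj_iff_vec] at hadj ⊢
    obtain ⟨-, -, hpq, hor⟩ := hadj
    have hv81 := hI81 v hv; have hw81 := hI81 w hw
    rw [(hφ9 v).1, (hφ9 w).1] at hpq hor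
    have hpq' : v / 9 ≠ w / 9 := fun e => hpq (by rw [e])
    refine ⟨hv81, hw81, hpq', ?_⟩
    rw [hvecφ v, hvecφ w] at hor
    have h3 := three_smul_eq_zero (cv (v / 9) - cv (w / 9))
    rcases hor with hor | hor
    · left
      rw [hid _ (by omega) _ (by omega) hpq'] at hor
      apply mv_inj a b c d hdet
      rw [mv_add, mv_two_smul]
      linear_combination hor + h3
    · right
      rw [hid _ (by omega) _ (by omega) (Ne.symm hpq')] at hor
      apply mv_inj a b c d hdet
      rw [mv_add]
      linear_combination hor
  obtain ⟨hI', hcard⟩ := hI.image φ hinj hrefl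
  have := h (I.image φ) hI' fun x hx => by
    obtain ⟨v, hv, rfl⟩ := mem_image.1 hx
    refine ⟨hφ81 v (hI81 v hv), ?_⟩
    rw [Nat.testBit_two_pow_sub_one]; simpa using hφ81 v (hI81 v hv)
  omega

/-! ## The holomorph `Hol(F₃²)` acting on labels and configurations -/

/-- Configuration number of four labels. [folklore] -/
def cfgOf4 (t1 t2 u1 u2 : ℕ) : ℕ := t1 + 18 * t2 + 324 * u1 + 5832 * u2

/-- `T`-labels of an assembled configuration. [folklore] -/
theorem labT_cfgOf4 {t1 t2 u1 u2 : ℕ} (h1 : t1 < 18) (h2 : t2 < 18) (i : ℕ) :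
    labT (cfgOf4 t1 t2 u1 u2) i = if i = 0 then 0 else if i = 1 then t1 else t2 := by
  unfold labT cfgOf4; split_ifs <;> omega

/-- `U`-labels of an assembled configuration. [folklore] -/
theorem labU_cfgOf4 {t1 t2 u1 u2 : ℕ} (h1 : t1 < 18) (h2 : t2 < 18) (h3 : u1 < 18) (h4 : u2 < 18) (j : ℕ) :
    labU (cfgOf4 t1 t2 u1 u2) j = if j = 0 then 0 else if j = 1 then u1 else u2 := by
  unfold labU cfgOf4; split_ifs <;> omega

/-- Assembled configurations are `< 18⁴`. [folklore] -/
theorem cfgOf4_lt {t1 t2 u1 u2 : ℕ} (h1 : t1 < 18) (h2 : t2 < 18) (h3 : u1 < 18) (h4 : u2 < 18) :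
    cfgOf4 t1 t2 u1 u2 < 104976 := by unfold cfgOf4; omega

/-- The element `(A, b)` of `Hol(F₃²)` (`A = ((a,b),(c,d))`, `b = (bx, by)`, entries `< 3`) acting on a label:
rotations `k ↦ A k`, reflections `k ↦ A k + b`. [folklore] -/
def holAct (a b c d bx by_ l : ℕ) : ℕ :=
  (a * (l % 3) + b * (l / 3 % 3) + l / 9 * bx) % 3 + 3 * ((c * (l % 3) + d * (l / 3 % 3) + l / 9 * by_) % 3) + 9 * (l / 9)

/-- `Hol(F₃²)` acting on configurations (all four labels). [folklore] -/
def holCfg (a b c d bx by_ n : ℕ) : ℕ :=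
  cfgOf4 (holAct a b c d bx by_ (n % 18)) (holAct a b c d bx by_ (n / 18 % 18)) (holAct a b c d bx by_ (n / 324 % 18))
    (holAct a b c d bx by_ (n / 5832 % 18))

/-- The holomorph maps labels to labels. [folklore] -/
theorem holAct_lt {l : ℕ} (hl : l < 18) (a b c d bx by_ : ℕ) : holAct a b c d bx by_ l < 18 := by unfold holAct; omega

/-- The holomorph fixes the identity label. [folklore] -/
theorem holAct_zero (a b c d bx by_ : ℕ) : holAct a b c d bx by_ 0 = 0 := by simp [holAct]

/-- `holCfg` yields a configuration `< 18⁴`. [folklore] -/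
theorem holCfg_lt (a b c d bx by_ n : ℕ) : holCfg a b c d bx by_ n < 104976 :=
  cfgOf4_lt (holAct_lt (Nat.mod_lt _ (by norm_num)) ..) (holAct_lt (Nat.mod_lt _ (by norm_num)) ..)
    (holAct_lt (Nat.mod_lt _ (by norm_num)) ..) (holAct_lt (Nat.mod_lt _ (by norm_num)) ..)

/-- `T`-labels of `holCfg`. [folklore] -/
theorem labT_holCfg (a b c d bx by_ n i : ℕ) : labT (holCfg a b c d bx by_ n) i = holAct a b c d bx by_ (labT n i) := by
  rw [holCfg, labT_cfgOf4 (holAct_lt (Nat.mod_lt _ (by norm_num)) ..) (holAct_lt (Nat.mod_lt _ (by norm_num)) ..)]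
  unfold labT; split_ifs <;> simp [holAct_zero]

/-- `U`-labels of `holCfg`. [folklore] -/
theorem labU_holCfg (a b c d bx by_ n j : ℕ) : labU (holCfg a b c d bx by_ n) j = holAct a b c d bx by_ (labU n j) := by
  rw [holCfg, labU_cfgOf4 (holAct_lt (Nat.mod_lt _ (by norm_num)) ..) (holAct_lt (Nat.mod_lt _ (by norm_num)) ..)
    (holAct_lt (Nat.mod_lt _ (by norm_num)) ..) (holAct_lt (Nat.mod_lt _ (by norm_num)) ..)]
  unfold labU; split_ifs <;> simp [holAct_zero]

/-- The action read in vectors, signs and reflection bits. [folklore] -/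
theorem vec_holAct {l : ℕ} (hl : l < 18) (a b c d bx by_ : ℕ) :
    vec (holAct a b c d bx by_ l) =
        mv (a : ZMod 3) (b : ZMod 3) (c : ZMod 3) (d : ZMod 3) (vec l) + rf l • (((bx : ℕ) : ZMod 3), ((by_ : ℕ) : ZMod 3)) ∧
      sg (holAct a b c d bx by_ l) = sg l ∧ rf (holAct a b c d bx by_ l) = rf l := by
  have h9 : holAct a b c d bx by_ l / 9 = l / 9 := by unfold holAct; omega
  have h0 : holAct a b c d bx by_ l % 3 = (a * (l % 3) + b * (l / 3 % 3) + l / 9 * bx) % 3 := by unfold holAct; omega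
  have h1 : holAct a b c d bx by_ l / 3 % 3 = (c * (l % 3) + d * (l / 3 % 3) + l / 9 * by_) % 3 := by unfold holAct; omega
  have hlt : holAct a b c d bx by_ l < 9 ↔ l < 9 := by unfold holAct; omega
  have hr : rf l = ((l / 9 : ℕ) : ZMod 3) := by
    unfold rf; split_ifs with h
    · rw [Nat.div_eq_of_lt h]; simp
    · rw [show l / 9 = 1 by omega]; simp
  refine ⟨?_, by simp only [sg, hlt], by simp only [rf, hlt]⟩
  ext
  · simp only [vec, mv, h0, ZMod.natCast_mod, Nat.cast_add, Nat.cast_mul, Prod.fst_add, Prod.smul_fst, smul_eq_mul, hr]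
  · simp only [vec, mv, h1, ZMod.natCast_mod, Nat.cast_add, Nat.cast_mul, Prod.snd_add, Prod.smul_snd, smul_eq_mul, hr]

/-- A label is a rotation (`rf = 0`, `sg = 1`) or a reflection (`rf = 1`, `sg = −1`). [folklore] -/
theorem rf_cases (l : ℕ) : (rf l = 0 ∧ sg l = 1) ∨ (rf l = 1 ∧ sg l = -1) := by
  unfold rf sg; split_ifs <;> simp

/-- The sign/offset bookkeeping of `dv_holCfg` with abstract entries (16 sign cases, each a ring identity). [folklore] -/
theorem hol_master (a b c d : ZMod 3) (vt vt' vu vu' B : ZMod 3 × ZMod 3) {rt rt' ru ru' st st' su su' : ZMod 3}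
    (h1 : (rt = 0 ∧ st = 1) ∨ (rt = 1 ∧ st = -1)) (h2 : (rt' = 0 ∧ st' = 1) ∨ (rt' = 1 ∧ st' = -1))
    (h3 : (ru = 0 ∧ su = 1) ∨ (ru = 1 ∧ su = -1)) (h4 : (ru' = 0 ∧ su' = 1) ∨ (ru' = 1 ∧ su' = -1)) :
    -(st' * su') • ((mv a b c d vt + rt • B) - (st * st') • (mv a b c d vt' + rt' • B) +
        (st * st') • ((mv a b c d vu + ru • B) - (su * su') • (mv a b c d vu' + ru' • B))) =
      mv a b c d (-(st' * su') • (vt - (st * st') • vt' + (st * st') • (vu - (su * su') • vu'))) +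
        -((rt + ru - 2 * (rt * ru)) • B) - -((rt' + ru' - 2 * (rt' * ru')) • B) := by
  rcases h1 with ⟨r1, s1⟩ | ⟨r1, s1⟩ <;> rcases h2 with ⟨r2, s2⟩ | ⟨r2, s2⟩ <;> rcases h3 with ⟨r3, s3⟩ | ⟨r3, s3⟩ <;>
    rcases h4 with ⟨r4, s4⟩ | ⟨r4, s4⟩ <;> subst r1 s1 r2 s2 r3 s3 r4 s4 <;> ext <;>
    simp only [mv, Prod.fst_add, Prod.snd_add, Prod.fst_sub, Prod.snd_sub, Prod.fst_neg, Prod.snd_neg, Prod.smul_fst,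
      Prod.smul_snd, smul_eq_mul] <;> ring

/-- The offset of position `p`: `−b` if exactly one of its two labels is a reflection. [folklore] -/
def holOff (bx by_ n p : ℕ) : ZMod 3 × ZMod 3 :=
  -((rf (labT n (p / 3)) + rf (labU n (p % 3)) - 2 * (rf (labT n (p / 3)) * rf (labU n (p % 3)))) •
    (((bx : ℕ) : ZMod 3), ((by_ : ℕ) : ZMod 3)))

/-- **`d` under the holomorph**: `d_{h·n}(p,q) = A d_n(p,q) + c_p − c_q`. [folklore] -/
theorem dv_holCfg (a b c d bx by_ n p q : ℕ) : dv (holCfg a b c d bx by_ n) p q =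
      mv (a : ZMod 3) (b : ZMod 3) (c : ZMod 3) (d : ZMod 3) (dv n p q) + holOff bx by_ n p - holOff bx by_ n q := by
  rw [dv_formula, dv_formula, labT_holCfg, labT_holCfg, labU_holCfg, labU_holCfg, holOff, holOff]
  set t := labT n (p / 3); set t' := labT n (q / 3); set u := labU n (p % 3); set u' := labU n (q % 3)
  obtain ⟨vt, st, -⟩ := vec_holAct (labT_lt n (p / 3)) a b c d bx by_
  obtain ⟨vt', st', -⟩ := vec_holAct (labT_lt n (q / 3)) a b c d bx by_
  obtain ⟨vu, su, -⟩ := vec_holAct (labU_lt n (p % 3)) a b c d bx by_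
  obtain ⟨vu', su', -⟩ := vec_holAct (labU_lt n (q % 3)) a b c d bx by_
  rw [vt, vt', vu, vu', st, st', su, su']
  exact hol_master _ _ _ _ _ _ _ _ _ (rf_cases t) (rf_cases t') (rf_cases u) (rf_cases u')

/-- **`Bound16` moves against the holomorph**: `Bound16 (h · n) → Bound16 n` for invertible `A`. [folklore] -/
theorem bound16_of_holCfg {a b c d : ℕ} (bx by_ : ℕ) (hdet : (a : ZMod 3) * d - b * c ≠ 0) (n : ℕ) :
    Bound16 (holCfg a b c d bx by_ n) → Bound16 n :=
  bound16_transport id (fun _ hp => hp) (fun _ _ _ _ h => h) _ _ _ _ hdet (holOff bx by_ n) fun p _ q _ _ =>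
    dv_holCfg a b c d bx by_ n p q

end Summit.MatrixMultiplication.OmegaCensus.DihC3Sq
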